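import Literature.AlgebraicGeometry.Pohlmann1968.NonSimpleCMAbelianVarietyHazamaCriterion
import Literature.AlgebraicGeometry.Pohlmann1968.NondegenerateCMTypeHodgeConjecture
import Literature.AlgebraicGeometry.Pohlmann1968.CMTypeRankLowerBoundsNumberField
import Literature.AlgebraicGeometry.ComplexMultiplication.PrimitiveCMTypeSimple
import Literature.NumberTheory.ComplexMultiplication.CMTypeInducedFromPrimitive
import HarnessLib

/-!
# EVERY abelian variety with complex multiplication by a CM field of degree `≤ 6` — of ANY CM type — has `B•(Aⁿ) ⊗ ℂ = D•(Aⁿ) ⊗ ℂ` and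
# satisfies the Hodge conjecture with all its powers

Layer `Literature/AlgebraicGeometry/Pohlmann1968`, namespace `Literature.AlgebraicGeometry.Pohlmann1968`; lane `lit-hodgefound` (Track 2
foundations library), prover seat `lit-hodgefound-p10`, generation 33, row «A2-26(hj)» (self-proposed 2026-08-28).  Theorems only; no `def`, no
instance, no named fact (net Literature debt 0).

`K` a CM field with `[K : ℚ] ≤ 6`, `Φ` ANY CM type of `K`, `A ⊨ (K; Φ)` (an abelian variety of dimension `≤ 3` with complex multiplication by
`𝓞_K` through `Φ`).  If `Φ` is primitive it is nondegenerate (the Ribet–Lenstra–Dodson bound `[K : ℚ] ≤ 2^{Rank − 1}` with Kubota's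
`Rank ≤ n + 1`, tree `isNondegenerate_of_isPrimitive_of_finrank_le_six`) and White–Hazama give `B•(Aⁿ) = D•(Aⁿ)` (tree
`IsNondegenerate.hodgeClassSpan_pow_eq_divisorClassesSpan`).  If not, its primitive sub-pair `(K₁, Φ₁)` (Streng I.3.5, tree
`exists_primitive_inducedCMType_eq_of_isCMField`, with minimality) is a PROPER subfield — **`two_le_finrank_of_not_isPrimitive`**: a
non-primitive type is induced from a proper subfield (tree `primitive_iff_forall_inducedCMType_eq_top`), which contains the minimal `K₁` —, so
`[K₁ : ℚ] ≤ 3` and `Φ₁` is nondegenerate; Hazama's criterion for `A ≅ B^h` on the algebraic carrier (tree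
`IsNondegenerate.hodgeClassSpan_pow_eq_divisorClassesSpan_inducedCMType`).  No hypothesis on `K` beyond CM of degree `≤ 6` (not Galois, not
abelian).  The tree had the SIMPLE case (`hodgeConjectureFor_powSucc_of_isSimple_of_isOfCMType_of_dim_le_three`) and the torus side
(`CMTorusInducedTypeHodgeClassesOfPower`, `ComplexTorusCMTypeModelsHodgeClassesDegreeLeSix`).

* **`two_le_finrank_of_not_isPrimitive`** (any number field with a CM type).
* **`hodgeClassSpan_pow_eq_divisorClassesSpan_of_finrank_le_six`**, **`hodgeConjectureFor_pow_of_finrank_le_six`**: `Bᵐ(Aⁿ) ⊗ ℂ = Dᵐ(Aⁿ) ⊗ ℂ`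
  and the Hodge conjecture for EVERY power `Aⁿ` of EVERY abelian variety with complex multiplication by a CM field of degree `≤ 6`, any type;
  `not_exists_exceptional_pow_of_finrank_le_six`.

## References

* [Gordon1999HodgeAVSurvey] B. B. Gordon, *A survey of the Hodge conjecture for abelian varieties* (1999), Thm. 6.4 (Hazama–Murty), §9.3.
* [Hazama2003CyclicCM] F. Hazama, J. Math. Sci. Univ. Tokyo 10 (2003), p. 582.
* [Streng2010] M. Streng, *Complex multiplication of abelian surfaces*, PhD thesis, Leiden (2010), Ch. I Def. 3.2, Lemma 3.5.
* [MoonenZarhin1999LowDim] B. Moonen, Yu. Zarhin, *Hodge classes on abelian varieties of low dimension*, Math. Ann. 315 (1999), Thm. 0.1.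
* [Shimura1998] G. Shimura, *Abelian Varieties with Complex Multiplication and Modular Functions* (1998), §6.2 Thm. 3, §8.2 Prop. 26.
-/

noncomputable section

open scoped Classical NumberField
open NumberField Module CategoryTheory CategoryTheory.Limits

namespace Literature.AlgebraicGeometry.Pohlmann1968

-- `open scoped`: the tree's action of `Aut(ℂ)` on `Hom(K, ℂ)` by composition (`ringEquivCompAction`) is a scoped instance
open scoped Literature.NumberTheory.ComplexMultiplication
open Literature.AlgebraicGeometry.Motives (CMType AbelianVariety)
open Literature.AlgebraicGeometry.HodgeTheory
open Literature.AlgebraicGeometry.VanGeemen1994 (hodgeClassSpan)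
open Literature.Barriers.HodgeConjecture (divisorClassesSpan)
open Literature.NumberTheory.ComplexMultiplication (IsPrimitive inducedCMType exists_primitive_inducedCMType_eq_of_isCMField
  primitive_iff_forall_inducedCMType_eq_top)
open Literature.AlgebraicGeometry.ComplexMultiplication (IsCMTypeRealisation isPrimitive_ringEquiv_complex_iff)

variable {K : Type} [Field K] [NumberField K]
  {A : AbelianVariety ℂ} {ι : 𝓞 K →+* End A} {θ : K →+* Module.End ℂ (complexBetti A.X 1)}

/-- **A NON-PRIMITIVE CM TYPE IS INDUCED FROM A PROPER SUBFIELD — its minimal (primitive) sub-pair `(K₁, Φ₁)` has `[K : K₁] ≥ 2`.**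
[cite: Streng2010, Ch. I Def. 3.2 and Lemma 3.5] [cite: Shimura1998, §8.2 Prop. 26] -/
theorem two_le_finrank_of_not_isPrimitive {Φ : CMType K} {K₁ : IntermediateField ℚ K} {Φ₁ : CMType K₁}
    (hmin : ∀ (K₂ : IntermediateField ℚ K) (Φ₂ : CMType K₂), inducedCMType (algebraMap K₂ K) Φ₂ = Φ →
      ∃ h : K₁ ≤ K₂, inducedCMType (IntermediateField.inclusion h : K₁ →+* K₂) Φ₁ = Φ₂)
    (φ₀ : K →+* ℂ) (hΦ : ¬ IsPrimitive (ℂ ≃+* ℂ) Φ.1 φ₀) : 2 ≤ Module.finrank K₁ K := by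
  have hsep : ¬ ∀ s t : K →+* ℂ,
      (∀ τ : ℂ ≃+* ℂ, ((τ : ℂ →+* ℂ).comp s ∈ Φ.1 ↔ (τ : ℂ →+* ℂ).comp t ∈ Φ.1)) → s = t :=
    fun h ↦ hΦ ((isPrimitive_ringEquiv_complex_iff Φ φ₀).2 h)
  rw [primitive_iff_forall_inducedCMType_eq_top Φ] at hsep
  push Not at hsep
  obtain ⟨K₂, Φ₂, h₂, hK₂⟩ := hsep
  obtain ⟨hle, -⟩ := hmin K₂ Φ₂ h₂
  have hK₁ : K₁ ≠ ⊤ := fun h ↦ hK₂ (top_le_iff.1 (h ▸ hle))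
  have h1 : Module.finrank K₁ K ≠ 1 := fun h ↦ hK₁ (IntermediateField.finrank_eq_one_iff_eq_top.1 h)
  have hpos : 0 < Module.finrank K₁ K := Module.finrank_pos
  omega

/-- `Bᵐ ⊗ ℂ = Dᵐ ⊗ ℂ` for all `m` on an abelian variety `B` gives the Hodge conjecture for `B` (Lefschetz `(1,1)`, cup products, tree theorems).
[cite: Gordon1999HodgeAVSurvey, §9.3] -/
private theorem hodgeConjectureFor_of_forall_hodgeClassSpan_eq₄₅ (B : AbelianVariety ℂ)
    (h : ∀ m : ℕ, hodgeClassSpan B.dim B.X m = divisorClassesSpan B.X B.dim m) : HodgeConjectureFor B.dim B.X :=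
  ⟨nonempty_hodgeModel_holds (Motives.AbelianVariety.isSmoothProjective_holds (A := B)),
    fun m _ hc hmm ↦ AbelianVariety.divisorClassesSpan_le_algebraicClasses B
      (fun b hb hb' ↦ lefschetzOneOne_rational_holds (Motives.AbelianVariety.isSmoothProjective_holds (A := B)) b hb hb') m
      ((h m) ▸ Submodule.subset_span ⟨hc, hmm⟩)⟩

/-- **`Bᵐ(Aⁿ) ⊗ ℂ = Dᵐ(Aⁿ) ⊗ ℂ` FOR ALL `n, m`, FOR EVERY CM TYPE OF EVERY CM FIELD OF DEGREE `≤ 6` AND EVERY REALISATION** (primitive: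
nondegenerate; imprimitive: the primitive sub-pair lives on a subfield of degree `≤ 3`, is nondegenerate, and Hazama's criterion applies).
[cite: Gordon1999HodgeAVSurvey, Thm. 6.4 and §9.3] [cite: Hazama2003CyclicCM, p. 582] [cite: Streng2010, Ch. I Lemma 3.5]
[cite: MoonenZarhin1999LowDim, Thm. 0.1] -/
theorem hodgeClassSpan_pow_eq_divisorClassesSpan_of_finrank_le_six [IsCMField K] (hK : Module.finrank ℚ K ≤ 6) (Φ : CMType K)
    (hA : IsCMTypeRealisation Φ A ι θ) (n m : ℕ) :
    hodgeClassSpan (⨁ fun _ : Fin n => A).dim (⨁ fun _ : Fin n => A).X m =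
      divisorClassesSpan (⨁ fun _ : Fin n => A).X (⨁ fun _ : Fin n => A).dim m := by
  obtain ⟨φ₀⟩ : Nonempty (K →+* ℂ) := inferInstance
  by_cases hΦ : IsPrimitive (ℂ ≃+* ℂ) Φ.1 φ₀
  · exact (isNondegenerate_of_isPrimitive_of_finrank_le_six Φ hK φ₀ hΦ).hodgeClassSpan_pow_eq_divisorClassesSpan hA n m
  obtain ⟨K₁, Φ₁, hCM, h₁, hp₁, hmin⟩ := exists_primitive_inducedCMType_eq_of_isCMField Φ
  haveI := hCM
  have h2 := two_le_finrank_of_not_isPrimitive hmin φ₀ hΦ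
  have hmul : Module.finrank ℚ K₁ * Module.finrank K₁ K = Module.finrank ℚ K := Module.finrank_mul_finrank ℚ K₁ K
  have hK₁ : Module.finrank ℚ K₁ ≤ 6 := by
    have h : Module.finrank ℚ K₁ * 2 ≤ Module.finrank ℚ K := hmul ▸ Nat.mul_le_mul_left _ h2
    omega
  obtain ⟨s₀⟩ : Nonempty (K₁ →+* ℂ) := inferInstance
  have hp : IsPrimitive (ℂ ≃+* ℂ) Φ₁.1 s₀ := (isPrimitive_ringEquiv_complex_iff Φ₁ s₀).2 hp₁
  exact (isNondegenerate_of_isPrimitive_of_finrank_le_six Φ₁ hK₁ s₀ hp).hodgeClassSpan_pow_eq_divisorClassesSpan_inducedCMType h₁ hA n m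

/-- **THE HODGE CONJECTURE FOR EVERY POWER OF EVERY ABELIAN VARIETY WITH COMPLEX MULTIPLICATION BY A CM FIELD OF DEGREE `≤ 6`**, any CM type
(abelian varieties of dimension `≤ 3` with `𝓞_K ↪ End A` through a CM type, and all their powers), UNCONDITIONALLY.
[cite: Gordon1999HodgeAVSurvey, Thm. 6.4 and §9.3] [cite: Hazama2003CyclicCM, p. 582] [cite: MoonenZarhin1999LowDim, Thm. 0.1] -/
theorem hodgeConjectureFor_pow_of_finrank_le_six [IsCMField K] (hK : Module.finrank ℚ K ≤ 6) (Φ : CMType K)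
    (hA : IsCMTypeRealisation Φ A ι θ) (n : ℕ) :
    HodgeConjectureFor (⨁ fun _ : Fin n => A).dim (⨁ fun _ : Fin n => A).X :=
  hodgeConjectureFor_of_forall_hodgeClassSpan_eq₄₅ _ (fun m ↦ hodgeClassSpan_pow_eq_divisorClassesSpan_of_finrank_le_six hK Φ hA n m)

/-- **No power of an abelian variety with complex multiplication by a CM field of degree `≤ 6` carries an exceptional Hodge class.**
[cite: Gordon1999HodgeAVSurvey, Thm. 6.4] [cite: MoonenZarhin1999LowDim, Thm. 0.1] -/
theorem not_exists_exceptional_pow_of_finrank_le_six [IsCMField K] (hK : Module.finrank ℚ K ≤ 6) (Φ : CMType K)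
    (hA : IsCMTypeRealisation Φ A ι θ) (n m : ℕ) :
    ¬ ∃ c : complexBetti (⨁ fun _ : Fin n => A).X (2 * m), IsRationalClass c ∧
        IsOfHodgeType (⨁ fun _ : Fin n => A).dim (⨁ fun _ : Fin n => A).X (2 * m) m m c ∧
        c ∉ divisorClassesSpan (⨁ fun _ : Fin n => A).X (⨁ fun _ : Fin n => A).dim m := by
  rintro ⟨c, hcQ, hcH, hcD⟩
  exact hcD ((hodgeClassSpan_pow_eq_divisorClassesSpan_of_finrank_le_six hK Φ hA n m) ▸ Submodule.subset_span ⟨hcQ, hcH⟩)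

end Literature.AlgebraicGeometry.Pohlmann1968

end
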